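import Literature.NumberTheory.LFunctions.DHCoreInequality
import Literature.NumberTheory.LFunctions.DHMaximalZero
import Literature.NumberTheory.LFunctions.ZetaZerosJensen
import HarnessLib

/-!
# The Deuring–Heilbronn phenomenon for `ζ(s)L(s, χ₁)` at moderate `λ₁` (Heath-Brown 1992, Lemma 8.1)

Topic `Literature/NumberTheory/LFunctions`, sub-namespace `DHTest`. Everything here is PROVED
(no definitions).

Heath-Brown 1992, **Lemma 8.1** (with `f(t) = x₀ − t`): if `λ₁ ≤ λ₀ ≤ λ` then
`λ₀ ≥ 0.3915 log λ₁⁻¹ − 1.157`; more generally (Lemma 6.1) every zero `ρ₀ ≠ β₁` of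
`ζ(s)L(s, χ₁)` is repelled by the exceptional zero `β₁ = 1 − λ₁/L`. Heath-Brown works with
`λ₀ ≤ (1/3) log log L` (because of the shift `e^{αt}`); the smoothing of the triangle
(`DeuringHeilbronnTestFunction`) and the unshifted left-line bounds (`DHTestFunctionBounds`)
let the same positivity argument run as long as `e^{4λ₀} ≪ L⁵`, i.e. for `λ₁ ≫ L^{−5}`.
With the crude growth constant `0.861` in Lemma 3.1 and `x₀ = 4` we obtain (`deuringHeilbronn_moderate`):

there are absolute `C_r, c_λ, L₀ > 0` such that for `q` with `L = log q ≥ L₀`, a primitive quadratic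
`χ` mod `q`, a simple real zero `β₁` of `L(·, χ)` with `C_r/L⁵ ≤ λ₁ = (1−β₁)L ≤ c_λ`, every zero
`ρ ≠ β₁` of `ζ(s)L(s, χ)` with `Re ρ ≥ 1/2`, `|Im ρ| ≤ q^{1/100}` satisfies
`(1 − Re ρ) L ≥ (1/4) log(1/λ₁) − (log 400)/4 − 1`.

Proof: `core_inequality` for the penalised-maximal zero (`DHMaximalZero`), the monotonicity step
`Re{H(−λ₀+iμ) − H(λ₁−λ₀+iμ)} ≤ λ₁x₀e^{λ₀x₀}H(0)`, `H(0) ≥ 7.64`, `h(0) ≤ 4`, the main cost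
`4 · 0.861 · (2 + 4/100) L`, and the error bounds of `DHFarZeroBounds`; all lower-order terms are
`O(log L)` and are absorbed for `L ≥ L₀`.

## References

* D. R. Heath-Brown, Proc. London Math. Soc. (3) 64 (1992), Lemma 6.1, Lemma 8.1, Tables 4–7.
  [cite: HeathBrown1992PLMS, Lemma 8.1]
-/

noncomputable section

open Complex Real MeasureTheory Set Filter Topology Metric Asymptotics

namespace Literature.NumberTheory.LFunctions

namespace DHTest

open ExplicitPsiChar LaplaceShape

/-! ### Numerical facts -/

/-- `H(0) ≥ 7.64` for the shape with `x₀ = 4`, `ε₂ = ε₀ = 1/100`. [folklore] -/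
theorem H0_ge : (7.64 : ℝ) ≤ (shapeLaplace (shape 4 (1 / 100) (1 / 100)) 4 0).re := by
  have h := shapeLaplace_shape_zero_ge (x₀ := 4) (ε₂ := 1 / 100) (ε₀ := 1 / 100) (by norm_num) (by norm_num)
    (by norm_num)
  refine le_trans ?_ h
  have he : (0.96 : ℝ) ≤ Real.exp (-(1 / 100 * 4)) := by
    have := Real.add_one_le_exp (-(1 / 100 * 4 : ℝ)); norm_num at this ⊢; linarith
  have : (0.96 : ℝ) * ((4 - 1 / 100) ^ 2 / 2) ≤ Real.exp (-(1 / 100 * 4)) * ((4 - 1 / 100) ^ 2 / 2) :=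
    mul_le_mul_of_nonneg_right he (by norm_num)
  norm_num at this ⊢
  linarith

/-- `3.99 ≤ h(0) ≤ 4`. [folklore] -/
theorem h0_mem : (3.99 : ℝ) ≤ shape 4 (1 / 100) (1 / 100) 0 ∧ shape 4 (1 / 100) (1 / 100) 0 ≤ 4 := by
  constructor
  · have := shape_zero_ge (x₀ := 4) (ε₂ := 1 / 100) (ε₀ := 1 / 100) (by norm_num) (by norm_num)
    norm_num at this ⊢; linarith
  · exact shape_zero_le (x₀ := 4) (ε₂ := 1 / 100) (ε₀ := 1 / 100) (by norm_num) (by norm_num)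

/-- Eventual domination: for `A ≥ 0`, `B` real and `c > 0` there is `L₀ > 0` with `A log L + B ≤ c L`
for `L ≥ L₀`. [folklore] -/
theorem exists_log_linear_le {A B c : ℝ} (hA : 0 ≤ A) (hc : 0 < c) :
    ∃ L₀ : ℝ, 0 < L₀ ∧ ∀ L, L₀ ≤ L → A * Real.log L + B ≤ c * L := by
  have h1 : ∀ᶠ L in atTop, ‖Real.log L‖ ≤ (c / (2 * (A + 1))) * ‖L‖ :=
    (Asymptotics.isLittleO_iff.1 Real.isLittleO_log_id_atTop) (by positivity)
  have h2 : ∀ᶠ L : ℝ in atTop, 2 * B / c ≤ L := eventually_ge_atTop _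
  have h3 : ∀ᶠ L : ℝ in atTop, 1 ≤ L := eventually_ge_atTop _
  obtain ⟨L₀, hL₀⟩ := Filter.eventually_atTop.1 (h1.and (h2.and h3))
  refine ⟨max L₀ 1, by positivity, fun L hL ↦ ?_⟩
  obtain ⟨e1, e2, e3⟩ := hL₀ L ((le_max_left _ _).trans hL)
  rw [Real.norm_eq_abs, Real.norm_eq_abs, abs_of_nonneg (Real.log_nonneg e3), abs_of_pos (by linarith)] at e1
  have e4 : A * Real.log L ≤ A * (c / (2 * (A + 1)) * L) := mul_le_mul_of_nonneg_left e1 hA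
  have e5 : A * (c / (2 * (A + 1)) * L) ≤ c / 2 * L := by
    rw [show A * (c / (2 * (A + 1)) * L) = (A / (A + 1)) * (c / 2 * L) by field_simp]
    exact mul_le_of_le_one_left (by positivity) ((div_le_one (by positivity)).2 (by linarith))
  have e6 : B ≤ c / 2 * L := by
    rw [div_le_iff₀ hc] at e2; linarith
  linarith

/-! ### The theorem -/

set_option maxHeartbeats 40000000 in
/-- **Deuring–Heilbronn at moderate `λ₁`** (Heath-Brown 1992, Lemma 6.1/Lemma 8.1, smoothed
triangle, `x₀ = 4`): there are absolute `C_r, c_λ, L₀ > 0` such that for every `q` with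
`L = log q ≥ L₀`, every primitive quadratic `χ` mod `q`, every simple real zero `β₁` of `L(·, χ)`
with `C_r/L⁵ ≤ λ₁ = (1 − β₁)L ≤ c_λ`, and every zero `ρ ≠ β₁` of `ζ(s)L(s, χ)` with `Re ρ ≥ 1/2`,
`|Im ρ| ≤ e^{L/100}`: `(1/4) log(1/λ₁) − (log 400)/4 − 1 ≤ (1 − Re ρ)L`.
[cite: HeathBrown1992PLMS, Lemma 8.1] -/
theorem deuringHeilbronn_moderate :
    ∃ C_r c_l L₀ : ℝ, 0 < C_r ∧ 0 < c_l ∧ 0 < L₀ ∧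
      ∀ (q : ℕ) [NeZero q] (χ : DirichletCharacter ℂ q), χ.IsPrimitive → χ.IsQuadratic →
        L₀ ≤ Real.log q →
        ∀ β₁ : ℝ, χ.LFunction β₁ = 0 → DirichletDisc.zeroOrder χ β₁ = 1 →
          C_r / Real.log q ^ 5 ≤ (1 - β₁) * Real.log q → (1 - β₁) * Real.log q ≤ c_l →
          ∀ ρ : ℂ, (riemannZeta ρ = 0 ∨ χ.LFunction ρ = 0) → ρ ≠ β₁ → 1 / 2 ≤ ρ.re →
            |ρ.im| ≤ Real.exp (Real.log q / 100) →
            1 / 4 * Real.log (1 / ((1 - β₁) * Real.log q)) - (Real.log 400 / 4 + 1) ≤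
              (1 - ρ.re) * Real.log q := by
  /- ─────────── constants ─────────── -/
  have hε : (0 : ℝ) < 1 / 100 := by norm_num
  have hεx : (1 / 100 : ℝ) ≤ 4 := by norm_num
  have hx₀ : (0 : ℝ) ≤ 4 := by norm_num
  obtain ⟨M₂, hM₂0, hM₂⟩ := exists_bound_iteratedDeriv (shape_contDiff 4 (1 / 100) (1 / 100)) 4 2
  obtain ⟨M₆, hM₆0, hM₆⟩ := exists_bound_iteratedDeriv (shape_contDiff 4 (1 / 100) (1 / 100)) 4 6
  obtain ⟨Cwχ, hCwχ0, hCwχ⟩ := exists_sum_window_le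
  obtain ⟨Cwζ, hCwζ0, hCwζ⟩ := exists_sum_zetaZeroWindow_le
  obtain ⟨Cfχ, hCfχ0, hCfχ⟩ := norm_far_char_le
  obtain ⟨Cfζ, hCfζ0, hCfζ⟩ := norm_far_zeta_le
  obtain ⟨CJχ, hCJχ0, hCJχ⟩ := norm_charEFRemainder_testFn_le
  obtain ⟨CJζ, hCJζ0, hCJζ⟩ := norm_smoothedEFRemainder_testFn_le
  set hfun := shape 4 (1 / 100) (1 / 100) with hhfun
  set h₀ : ℝ := hfun 0 with hh₀
  set h₁ : ℝ := |deriv hfun 0| with hh₁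
  set H0 : ℝ := (shapeLaplace hfun 4 0).re with hH0
  obtain ⟨hh₀ge, hh₀le⟩ := h0_mem
  have hH0ge : (7.64 : ℝ) ≤ H0 := H0_ge
  set Cw : ℝ := Cwχ + Cwζ with hCw
  have hCw0 : 0 < Cw := by positivity
  set δ : ℝ := min (1 / 100) (1 / (1464 * Cw + 1)) with hδdef
  have hδ0 : 0 < δ := lt_min (by norm_num) (by positivity)
  have hδ1 : δ ≤ 1 / 100 := min_le_left _ _
  have hδCw : 3.6524 * Cw * δ ≤ 0.0025 := by
    have h1 : δ ≤ 1 / (1464 * Cw + 1) := min_le_right _ _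
    have h2 : 3.6524 * Cw * δ ≤ 3.6524 * Cw * (1 / (1464 * Cw + 1)) :=
      mul_le_mul_of_nonneg_left h1 (by positivity)
    refine h2.trans ?_
    rw [mul_one_div, div_le_iff₀ (by positivity)]
    linarith
  set S₀ : ℝ := ∑ j ∈ Finset.range 6, |iteratedDeriv j hfun 0| with hS₀
  have hS₀0 : 0 ≤ S₀ := Finset.sum_nonneg fun _ _ ↦ abs_nonneg _
  set Sδ : ℝ := ∑ j ∈ Finset.Ico 1 6, |iteratedDeriv j hfun 0| * (2 / δ) ^ (j - 1) with hSδ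
  have hSδ0 : 0 ≤ Sδ := Finset.sum_nonneg fun _ _ ↦ by positivity
  set C_B : ℝ := Real.log 400 / 4 + 1 with hC_B
  -- the range constant `C_r`
  set E8 : ℝ := Real.exp (8 - 4 * C_B) with hE8
  set Kχ : ℝ := Cfχ / δ ^ 2 * 2.01 * (4 * M₆ * (2 / δ) ^ 4 * E8) with hKχ
  set Kζ : ℝ := Cfζ / δ ^ 2 * 2.01 * (4 * M₆ * (2 / δ) ^ 4 * E8) with hKζ
  have hKχ0 : 0 ≤ Kχ := by positivity
  have hKζ0 : 0 ≤ Kζ := by positivity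
  set C_r : ℝ := 200 * (Kχ + Kζ) + 256 * M₆ * Real.exp (4 - 4 * C_B) / δ ^ 6 + 1 with hC_r
  have hC_r1 : 1 ≤ C_r := by
    have : 0 ≤ 200 * (Kχ + Kζ) + 256 * M₆ * Real.exp (4 - 4 * C_B) / δ ^ 6 := by positivity
    simp only [hC_r]; linarith
  have hC_r0 : 0 < C_r := by linarith
  -- the lower-order coefficient
  set C_E : ℝ := 5 * Real.log 2 + 2 * Real.log DirichletDisc.Zc + Real.log 3 + 2 * Real.log 21 +
    2 * Real.log 4 with hC_E
  have hC_E0 : 0 ≤ C_E := by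
    have := Real.log_nonneg DirichletDisc.one_le_Zc
    have h2 := Real.log_nonneg (by norm_num : (1:ℝ) ≤ 2)
    have h3 := Real.log_nonneg (by norm_num : (1:ℝ) ≤ 3)
    have h21 := Real.log_nonneg (by norm_num : (1:ℝ) ≤ 21)
    have h4 := Real.log_nonneg (by norm_num : (1:ℝ) ≤ 4)
    positivity
  set c_low : ℝ := (2 * S₀ / δ + 1) + 4 * 0.861 * (22 + C_E) + 0.04 + 200 * Cw +
      2 * (Cfχ / δ ^ 2 * 2.01 * (24 + Sδ)) + 2 * (Cfζ / δ ^ 2 * 2.01 * (24 + Sδ)) +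
      2 * (CJχ * 2.01 * (24 + 4 * h₁ + 16 * M₂)) + 2 * (CJζ * 2.01 * (24 + 4 * h₁ + 16 * M₂)) +
      4 * (24 + 4 * h₁ + 16 * M₂) with hc_low
  have hc_low0 : 0 ≤ c_low := by simp only [hc_low]; positivity
  -- `L₀`: `c_low (9/4 log L + log C_r/4 + 1) ≤ 0.3 L`, `5 log L + log C_r + 8 ≤ δ L`, `L ≥ 4`
  obtain ⟨L₁, hL₁0, hL₁⟩ := exists_log_linear_le (A := c_low * (9 / 4)) (B := c_low * (Real.log C_r / 4 + 1))
    (c := 0.3) (by positivity) (by norm_num)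
  obtain ⟨L₂, hL₂0, hL₂⟩ := exists_log_linear_le (A := 5) (B := Real.log C_r + 8) (c := δ)
    (by norm_num) hδ0
  refine ⟨C_r, δ, max (max L₁ L₂) 4, hC_r0, hδ0, by positivity, ?_⟩
  /- ─────────── the data ─────────── -/
  intro q _ χ hprim hquad hL₀ β₁ hLβ₁ hm₁ hr₁ hr₂ ρs hρs hρsβ₁ hρsre hρsim
  set L : ℝ := Real.log q with hLdef
  have hL4 : 4 ≤ L := (le_max_right _ _).trans hL₀
  have hL1 : 1 ≤ L := by linarith
  have hL0 : 0 < L := by linarith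
  have hLL₁ : L₁ ≤ L := ((le_max_left _ _).trans (le_max_left _ _)).trans hL₀
  have hLL₂ : L₂ ≤ L := ((le_max_right _ _).trans (le_max_left _ _)).trans hL₀
  have hlogL0 : 0 ≤ Real.log L := Real.log_nonneg hL1
  have hq : 1 < q := by
    by_contra h'
    have : (q : ℝ) ≤ 1 := by exact_mod_cast not_lt.1 h'
    have := Real.log_nonpos (Nat.cast_nonneg q) this
    linarith
  have hχ : χ ≠ 1 := ne_one_of_isPrimitive hprim hq
  set lam₁ : ℝ := (1 - β₁) * L with hlam₁
  have hlam₁pos : 0 < lam₁ := lt_of_lt_of_le (by positivity) hr₁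
  have hlam₁le : lam₁ ≤ δ := hr₂
  have hβ₁1 : β₁ < 1 := by
    by_contra h'
    have : lam₁ ≤ 0 := mul_nonpos_of_nonpos_of_nonneg (by linarith [not_lt.1 h']) hL0.le
    linarith
  have h1β₁ : 1 - β₁ ≤ δ / L := by rw [le_div_iff₀ hL0]; exact hlam₁le
  have h1β₁' : 1 - β₁ ≤ δ := h1β₁.trans (div_le_self hδ0.le hL1)
  have hβ₁0 : 0 < β₁ := by linarith
  set Λ : ℝ := 1 / 4 * Real.log (1 / lam₁) with hΛ
  -- `Λ ≤ (5/4) log L - (1/4) log C_r ≤ (5/4) log L + (1/4)|log C_r|`…; we use `Λ ≤ (5 log L - log C_r)/4`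
  have hΛle : Λ ≤ (5 * Real.log L - Real.log C_r) / 4 := by
    simp only [hΛ]
    have h1 : Real.log (1 / lam₁) ≤ Real.log (L ^ 5 / C_r) := by
      refine Real.log_le_log (by positivity) ?_
      rw [div_le_div_iff₀ hlam₁pos hC_r0, one_mul]
      rw [div_le_iff₀ (by positivity)] at hr₁
      linarith
    rw [Real.log_div (by positivity) hC_r0.ne', Real.log_pow] at h1
    push_cast at h1
    linarith
  have hΛnn : 0 ≤ Λ := by
    simp only [hΛ]
    have : 1 ≤ 1 / lam₁ := by rw [le_div_iff₀ hlam₁pos]; linarith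
    have := Real.log_nonneg this
    positivity
  by_contra hcon
  push Not at hcon
  -- `λ* < Λ - C_B`
  set lams : ℝ := (1 - ρs.re) * L with hlams
  have hlams_lt : lams < Λ - C_B := by simp only [hlams, hΛ, hC_B] at hcon ⊢; linarith
  have hlams0 : 0 ≤ lams := by
    have : ρs.re ≤ 1 := by
      rcases hρs with h | h
      · exact (re_lt_one_of_riemannZeta_eq_zero h).le
      · by_contra h'; exact DirichletCharacter.LFunction_ne_zero_of_one_le_re χ (Or.inl hχ) (not_le.1 h').le h
    exact mul_nonneg (by linarith) hL0.le
  have hC_B1 : 1 ≤ C_B := by simp only [hC_B]; have := Real.log_nonneg (by norm_num : (1:ℝ) ≤ 400); linarith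
  have hΛC : C_B ≤ Λ := by linarith
  /- ─────────── the maximal zero ─────────── -/
  set Y₀ : ℝ := Real.exp (L / 100) with hY₀
  have hY₀1 : 1 ≤ Y₀ := Real.one_le_exp (by positivity)
  have hY₀0 : 0 < Y₀ := by linarith
  set Y : ℝ := (lams + 2) * Y₀ with hY
  have hYs : |ρs.im| ≤ Y := hρsim.trans (le_mul_of_one_le_left hY₀0.le (by linarith))
  obtain ⟨ρ₀, hρ₀z, hρ₀β₁, hρ₀re, hρ₀im, hsc, hmax⟩ :=
    exists_maximal_zero hχ (β₁ : ℂ) (1 / (Y₀ * L)) Y hρs hρsβ₁ hρsre hYs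
  have hρ₀re1 : ρ₀.re < 1 := by
    rcases hρ₀z with h | h
    · exact re_lt_one_of_riemannZeta_eq_zero h
    · by_contra h'; exact DirichletCharacter.LFunction_ne_zero_of_one_le_re χ (Or.inl hχ) (not_lt.1 h') h
  obtain ⟨hm1, hm2, hm3⟩ := maximality_consequences (δ := δ) hY₀0 hL0 hρsim hρ₀re1.le hsc
  set lam₀ : ℝ := (1 - ρ₀.re) * L with hlam₀
  set γ₀ : ℝ := ρ₀.im with hγ₀
  have hlam₀le : lam₀ ≤ lams + 1 := hm1
  have hlam₀lt : lam₀ < Λ - C_B + 1 := by linarith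
  have hlam₀nn : 0 ≤ lam₀ := mul_nonneg (by linarith) hL0.le
  have hlam₀Λ : lam₀ ≤ Λ := by linarith
  have hγ₀le : |γ₀| ≤ (lams + 1) * Y₀ := hm2
  have hγ₀Λ : |γ₀| ≤ (Λ + 1) * Y₀ := hγ₀le.trans (mul_le_mul_of_nonneg_right (by linarith) hY₀0.le)
  -- `(Λ + 2)/L ≤ δ/4`
  have hlogCr : 0 ≤ Real.log C_r := Real.log_nonneg hC_r1
  have hΛL : Λ + 2 ≤ δ * L / 4 := by
    have := hL₂ L hLL₂
    linarith
  have hl₀δ : 1 - ρ₀.re ≤ δ := by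
    have h1 : (1 - ρ₀.re) * L ≤ δ * L := by
      have : δ * L / 4 ≤ δ * L := by
        have := mul_nonneg hδ0.le hL0.le; linarith
      linarith
    exact le_of_mul_le_mul_right h1 hL0
  have hl₀δ4 : lam₀ / L ≤ δ / 4 := by rw [div_le_iff₀ hL0]; linarith
  -- maximality in the form needed by `core_inequality`
  have hmax' : ∀ ρ : ℂ, (riemannZeta ρ = 0 ∨ χ.LFunction ρ = 0) → ρ ≠ β₁ → 1 - δ ≤ ρ.re →
      |ρ.im| ≤ |ρ₀.im| + δ → ρ.re ≤ ρ₀.re + (1 / 100) / L := by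
    intro ρ hz hb hre him
    have hadm : 1 / 2 ≤ ρ.re := by linarith
    have hY' : |ρ.im| ≤ Y := by
      have : |ρ₀.im| + δ ≤ Y := by
        have e : Y = (lams + 1) * Y₀ + Y₀ := by simp only [hY]; ring
        rw [e]; rw [hγ₀] at hγ₀le
        linarith
      exact him.trans this
    have h1 := hm3 ρ (hmax ρ hz hb hadm hY') him
    have h2 : δ / (Y₀ * L) ≤ (1 / 100) / L := by
      rw [div_le_div_iff₀ (by positivity) hL0]
      calc δ * L ≤ 1 / 100 * L := mul_le_mul_of_nonneg_right hδ1 hL0.le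
        _ ≤ 1 / 100 * (Y₀ * L) :=
          mul_le_mul_of_nonneg_left (le_mul_of_one_le_left hL0.le hY₀1) (by norm_num)
    linarith
  /- ─────────── the core inequality ─────────── -/
  have core := core_inequality hprim hquad hq (x₀ := 4) (ε₂ := 1 / 100) (ε₀ := 1 / 100) (L := L) (δ := δ)
    hε hεx hL4 hδ0 (by linarith) hβ₁0 hβ₁1 hLβ₁ hm₁ h1β₁' hρ₀z hρ₀β₁ hρ₀re1 hl₀δ hmax'
  simp only at core
  rw [← hlam₀, ← hlam₁, ← hγ₀] at core
  /- ─────────── notation for the pieces ─────────── -/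
  set σ₀ : ℝ := 1 + 1 / L with hσ₀
  set α : ℝ := lam₀ + 1 with hα
  set g := testFn 4 (1 / 100) (1 / 100) L α with hg
  set Hf := shapeLaplace hfun 4 with hHf
  have hσ₀1 : σ₀ - 1 = 1 / L := by simp only [hσ₀]; ring
  have hσ₀gt : 1 < σ₀ := by simp only [hσ₀]; have := one_div_pos.2 hL0; linarith
  have hσ₀lt : σ₀ < 3 / 2 := by
    simp only [hσ₀]; have : 1 / L ≤ 1 / 4 := one_div_le_one_div_of_le (by norm_num) hL4; linarith
  have hα0 : 0 ≤ α := by simp only [hα]; linarith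
  have hαΛ : α ≤ Λ + 1 := by simp only [hα]; linarith
  have hαL4 : α ≤ L / 4 := by
    have : Λ + 1 ≤ L / 4 := by
      have : δ * L / 4 ≤ L / 4 := by
        have := mul_le_mul_of_nonneg_right (show δ ≤ 1 by linarith) hL0.le; linarith
      linarith
    linarith
  have hαL : α / L ≤ δ / 4 := by
    rw [div_le_iff₀ hL0]; linarith
  have hcenter : |σ₀ - α / L - 1| ≤ δ / 4 := by
    have e : σ₀ - α / L - 1 = -(lam₀ / L) := by simp only [hσ₀, hα]; field_simp; ring
    rw [e, abs_neg, abs_of_nonneg (by positivity)]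
    exact hl₀δ4
  set Λ' : ℝ := Λ + Real.log L + 1 with hΛ'
  have hΛ'1 : 1 ≤ Λ' := by simp only [hΛ']; linarith
  have hΛ'Λ : Λ ≤ Λ' := by simp only [hΛ']; linarith
  have hΛ'log : Real.log L ≤ Λ' := by simp only [hΛ']; linarith
  have hΛ'Λ1 : Λ + 1 ≤ Λ' := by simp only [hΛ']; linarith
  -- `log(Λ + 5) ≤ Λ + 4`
  have hlogΛ : Real.log (Λ + 5) ≤ Λ + 4 := by
    have := Real.log_le_sub_one_of_pos (by linarith : (0:ℝ) < Λ + 5); linarith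
  have hlogΛ0 : 0 ≤ Real.log (Λ + 5) := Real.log_nonneg (by linarith)
  -- `log(|γ₀| + 4) ≤ L/100 + log(Λ + 5)`
  have hlogγ : Real.log (|γ₀| + 4) ≤ L / 100 + Real.log (Λ + 5) := by
    have h1 : |γ₀| + 4 ≤ (Λ + 5) * Y₀ := by
      have h4 : 4 ≤ 4 * Y₀ := by linarith only [hY₀1]
      have e : (Λ + 5) * Y₀ = (Λ + 1) * Y₀ + 4 * Y₀ := by ring
      rw [e]; linarith only [hγ₀Λ, h4]
    calc Real.log (|γ₀| + 4) ≤ Real.log ((Λ + 5) * Y₀) :=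
          Real.log_le_log (by positivity) h1
      _ = Real.log (Λ + 5) + L / 100 := by
          rw [Real.log_mul (by linarith) hY₀0.ne', hY₀, Real.log_exp]
      _ = L / 100 + Real.log (Λ + 5) := by ring
  have hlogγL : Real.log (|γ₀| + 4) ≤ 1.01 * L := by
    have : Real.log (Λ + 5) ≤ L := by
      have : Λ + 4 ≤ L := by
        have : δ * L / 4 ≤ L / 4 := by
          have := mul_le_mul_of_nonneg_right (show δ ≤ 1 by linarith) hL0.le; linarith
        linarith
      linarith
    linarith
  have hlog1γ : Real.log (1 + |γ₀|) ≤ Real.log (|γ₀| + 4) :=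
    Real.log_le_log (by positivity) (by linarith)
  /- ─────────── (B1), (B2): monotonicity ─────────── -/
  have hmono₁ := re_shapeLaplace_sub_le (φ := hfun) (shape_continuous 4 (1/100) (1/100))
    (fun t ↦ shape_nonneg hε t) (X := 4) hx₀ hlam₁pos.le hlam₀nn 0
  have hmono₂ := re_shapeLaplace_sub_le (φ := hfun) (shape_continuous 4 (1/100) (1/100))
    (fun t ↦ shape_nonneg hε t) (X := 4) hx₀ hlam₁pos.le hlam₀nn (γ₀ * L)
  simp only [Complex.ofReal_zero, zero_mul, add_zero, Complex.sub_re] at hmono₁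
  rw [Complex.sub_re] at hmono₂
  -- `8 λ₁ e^{4λ₀} ≤ 0.02`
  have hexp4 : Real.exp (lam₀ * 4) ≤ Real.exp (4 - 4 * C_B) / lam₁ := by
    have h1 : lam₀ * 4 ≤ (4 - 4 * C_B) + Real.log (1 / lam₁) := by
      simp only [hΛ] at hlam₀lt ⊢; linarith
    calc Real.exp (lam₀ * 4) ≤ Real.exp ((4 - 4 * C_B) + Real.log (1 / lam₁)) := Real.exp_le_exp.2 h1
      _ = Real.exp (4 - 4 * C_B) / lam₁ := by
          rw [Real.exp_add, Real.exp_log (by positivity)]; ring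
  have hCB4 : Real.exp (4 - 4 * C_B) = 1 / 400 := by
    simp only [hC_B]
    rw [show (4 : ℝ) - 4 * (Real.log 400 / 4 + 1) = -Real.log 400 by ring, Real.exp_neg,
      Real.exp_log (by norm_num)]
    norm_num
  have h8 : 8 * lam₁ * Real.exp (lam₀ * 4) ≤ 0.02 := by
    have := mul_le_mul_of_nonneg_left hexp4 (by positivity : 0 ≤ 8 * lam₁)
    rw [hCB4] at this
    have e : 8 * lam₁ * (1 / 400 / lam₁) = 0.02 := by field_simp; norm_num
    linarith
  have hH0nn : 0 ≤ H0 := by linarith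
  have hT12 : L * ((Hf ((-lam₀ : ℝ) : ℂ)).re - (Hf ((lam₁ - lam₀ : ℝ) : ℂ)).re) +
      L * ((Hf (((-lam₀ : ℝ) : ℂ) + (γ₀ * L : ℝ) * I)).re -
        (Hf (((lam₁ - lam₀ : ℝ) : ℂ) + (γ₀ * L : ℝ) * I)).re) ≤ 0.02 * (L * H0) := by
    have h1 : L * ((Hf ((-lam₀ : ℝ) : ℂ)).re - (Hf ((lam₁ - lam₀ : ℝ) : ℂ)).re) ≤
        L * (lam₁ * 4 * Real.exp (lam₀ * 4) * H0) := mul_le_mul_of_nonneg_left hmono₁ hL0.le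
    have h2 : L * ((Hf (((-lam₀ : ℝ) : ℂ) + (γ₀ * L : ℝ) * I)).re -
        (Hf (((lam₁ - lam₀ : ℝ) : ℂ) + (γ₀ * L : ℝ) * I)).re) ≤
        L * (lam₁ * 4 * Real.exp (lam₀ * 4) * H0) := mul_le_mul_of_nonneg_left hmono₂ hL0.le
    have h3 : 2 * (L * (lam₁ * 4 * Real.exp (lam₀ * 4) * H0)) ≤ 0.02 * (L * H0) := by
      have h := mul_le_mul_of_nonneg_right h8 (mul_nonneg hL0.le hH0nn)
      have e : 2 * (L * (lam₁ * 4 * Real.exp (lam₀ * 4) * H0)) = 8 * lam₁ * Real.exp (lam₀ * 4) * (L * H0) := by ring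
      rw [e]; exact h
    linarith
  /- ─────────── (B3): the inserted term ─────────── -/
  have hlam₁inv : 1 / lam₁ ≤ L ^ 5 / C_r := by
    rw [div_le_div_iff₀ hlam₁pos hC_r0, one_mul]
    have := (div_le_iff₀ (by positivity : (0:ℝ) < L ^ 5)).1 hr₁
    linarith
  have hexp4' : Real.exp (lam₀ * 4) ≤ Real.exp (4 - 4 * C_B) * (L ^ 5 / C_r) :=
    hexp4.trans (by
      rw [div_eq_mul_one_div]
      exact mul_le_mul_of_nonneg_left hlam₁inv (Real.exp_nonneg _))
  have hIns : (if ‖(β₁ : ℂ) - (1 + γ₀ * I)‖ ≤ δ then (0 : ℝ)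
      else L * ‖Hf (((lam₁ - lam₀ : ℝ) : ℂ) + (γ₀ * L : ℝ) * I)‖) ≤ 2 * S₀ / δ + 1 := by
    split_ifs with hn
    · positivity
    · -- `|γ₀| ≥ δ/2`, so `‖W₁‖ ≥ δ L/2 ≥ 1`
      set W₁ : ℂ := ((lam₁ - lam₀ : ℝ) : ℂ) + (γ₀ * L : ℝ) * I with hW₁
      have hγ₀big : δ / 2 ≤ |γ₀| := by
        have h1 : δ < ‖(β₁ : ℂ) - (1 + γ₀ * I)‖ := not_le.1 hn
        have h2 : ‖(β₁ : ℂ) - (1 + γ₀ * I)‖ ≤ (1 - β₁) + |γ₀| := by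
          rw [show (β₁ : ℂ) - (1 + γ₀ * I) = ((β₁ - 1 : ℝ) : ℂ) + (-(γ₀ : ℂ) * I) by push_cast; ring]
          refine (norm_add_le _ _).trans ?_
          rw [Complex.norm_real, Real.norm_eq_abs, abs_of_nonpos (by linarith), norm_mul, norm_neg,
            Complex.norm_real, Complex.norm_I, mul_one, Real.norm_eq_abs]
          linarith
        have h3 : 1 - β₁ ≤ δ / 4 := h1β₁.trans (div_le_div_of_nonneg_left hδ0.le (by norm_num) hL4)
        linarith only [h1, h2, h3, hδ0]
      have hWim : δ * L / 2 ≤ ‖W₁‖ := by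
        have h1 := Complex.abs_im_le_norm W₁
        have e : W₁.im = γ₀ * L := by simp [hW₁]
        rw [e, abs_mul, abs_of_pos hL0] at h1
        have h2 := mul_le_mul_of_nonneg_right hγ₀big hL0.le
        linarith only [h1, h2]
      have hδL8 : 8 ≤ δ * L := by have := hL₂ L hLL₂; linarith only [this, hlogL0, hlogCr]
      have hW1 : 1 ≤ ‖W₁‖ := by linarith
      have hW0 : W₁ ≠ 0 := norm_pos_iff.1 (by linarith)
      have hWre : -lam₀ ≤ W₁.re := by simp [hW₁]; linarith
      have hb := norm_shapeLaplace_le_of_re_ge (x₀ := 4) (ε₂ := 1/100) (ε₀ := 1/100) hε hεx hM₆ hW0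
        hlam₀nn hWre
      -- `Σ_{j<6} |h_j|/‖W‖^{j+1} ≤ S₀ · (1/‖W‖)`, `1/‖W‖^6 ≤ (2/(δL))^6`
      have hinv : 1 / ‖W₁‖ ≤ 2 / (δ * L) := by
        rw [div_le_div_iff₀ (by linarith) (by positivity)]; linarith
      have hsumj : ∑ j ∈ Finset.range 6, |iteratedDeriv j hfun 0| / ‖W₁‖ ^ (j + 1) ≤ S₀ * (2 / (δ * L)) := by
        rw [hS₀, Finset.sum_mul]
        refine Finset.sum_le_sum fun j _ ↦ ?_
        rw [div_eq_mul_one_div]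
        refine mul_le_mul_of_nonneg_left ?_ (abs_nonneg _)
        refine le_trans ?_ hinv
        rw [one_div_le_one_div (by positivity) (by linarith)]
        calc ‖W₁‖ = ‖W₁‖ ^ 1 := (pow_one _).symm
          _ ≤ ‖W₁‖ ^ (j + 1) := pow_le_pow_right₀ hW1 (by omega)
      have hpow6 : 1 / ‖W₁‖ ^ 6 ≤ (2 / (δ * L)) ^ 6 := by
        rw [one_div, ← inv_pow, ← one_div]
        exact pow_le_pow_left₀ (by positivity) hinv 6
      have h6 : 4 * M₆ * Real.exp (lam₀ * 4) / ‖W₁‖ ^ 6 ≤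
          4 * M₆ * (Real.exp (4 - 4 * C_B) * (L ^ 5 / C_r)) * (2 / (δ * L)) ^ 6 := by
        rw [div_eq_mul_one_div]
        exact mul_le_mul (mul_le_mul_of_nonneg_left hexp4' (by positivity)) hpow6 (by positivity)
          (by positivity)
      have h6' : 4 * M₆ * (Real.exp (4 - 4 * C_B) * (L ^ 5 / C_r)) * (2 / (δ * L)) ^ 6 =
          (256 * M₆ * Real.exp (4 - 4 * C_B) / δ ^ 6 / C_r) * (1 / L) := by
        field_simp; ring
      have hCr' : 256 * M₆ * Real.exp (4 - 4 * C_B) / δ ^ 6 / C_r ≤ 1 := by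
        rw [div_le_one hC_r0]; simp only [hC_r]; linarith only [hKχ0, hKζ0]
      calc L * ‖Hf W₁‖ ≤ L * (S₀ * (2 / (δ * L)) + (256 * M₆ * Real.exp (4 - 4 * C_B) / δ ^ 6 / C_r) * (1 / L)) := by
            refine mul_le_mul_of_nonneg_left (hb.trans ?_) hL0.le
            rw [← h6']; linarith
        _ = 2 * S₀ / δ + 256 * M₆ * Real.exp (4 - 4 * C_B) / δ ^ 6 / C_r := by field_simp
        _ ≤ 2 * S₀ / δ + 1 := by linarith
  /- ─────────── (B4): the `E`-terms ─────────── -/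
  -- window counts
  have hTχ : ∀ t : ℝ, ∑ ρ ∈ nearZeros hχ t δ, (DirichletDisc.zeroOrder χ (ρ : ℂ) : ℝ) ≤
      Cwχ * (L + Real.log (|t| + 4)) := by
    intro t
    classical
    have e : ∑ ρ ∈ nearZeros hχ t δ, (DirichletDisc.zeroOrder χ (ρ : ℂ) : ℝ) =
        ∑ z ∈ (nearZeros hχ t δ).image Subtype.val, (DirichletDisc.zeroOrder χ z : ℝ) := by
      rw [Finset.sum_image (fun a _ b _ hab ↦ Subtype.ext hab)]
    rw [e]
    refine hCwχ q χ hprim hq t _ fun z hz ↦ ?_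
    obtain ⟨ρ, hρ, rfl⟩ := Finset.mem_image.1 hz
    have hn := mem_nearZeros.1 hρ
    have him : |(ρ : ℂ).im - t| ≤ 1 / 2 := by
      have := Complex.abs_im_le_norm ((ρ : ℂ) - (1 + t * I)); simp at this
      linarith [this.trans hn]
    exact ⟨ρ.2.1, ρ.2.2.1, ρ.2.2.2, him⟩
  have hTζ : ∀ t : ℝ, ∑ ρ ∈ nearZerosZeta t δ, (riemannZetaZeroOrder (ρ : ℂ) : ℝ) ≤
      Cwζ * Real.log (|t| + 2) := by
    intro t
    classical
    have e : ∑ ρ ∈ nearZerosZeta t δ, (riemannZetaZeroOrder (ρ : ℂ) : ℝ) =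
        ∑ z ∈ (nearZerosZeta t δ).image Subtype.val, (riemannZetaZeroOrder z : ℝ) := by
      rw [Finset.sum_image (fun a _ b _ hab ↦ Subtype.ext hab)]
    rw [e]
    refine le_trans (Finset.sum_le_sum_of_subset_of_nonneg ?_ fun z hz _ ↦ ?_) (hCwζ t)
    · intro z hz
      obtain ⟨ρ, hρ, rfl⟩ := Finset.mem_image.1 hz
      rw [Set.Finite.mem_toFinset]
      have hn := mem_nearZerosZeta.1 hρ
      have hre : 1 - δ ≤ (ρ : ℂ).re := by
        have := Complex.abs_re_le_norm ((ρ : ℂ) - (1 + t * I)); simp at this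
        linarith [abs_le.1 (this.trans hn)]
      have him : |(ρ : ℂ).im - t| ≤ 1 / 2 := by
        have := Complex.abs_im_le_norm ((ρ : ℂ) - (1 + t * I)); simp at this
        linarith [this.trans hn]
      exact ⟨ZetaZeros.riemannZetaNontrivialZeros.zeta_eq_zero ρ.2, by linarith, him⟩
    · exact riemannZetaZeroOrder_nonneg_of_zero ((Set.Finite.mem_toFinset _).1 hz).1
  have hTχ' : ∀ t : ℝ, (t = 0 ∨ t = γ₀) → ∑ ρ ∈ nearZeros hχ t δ, (DirichletDisc.zeroOrder χ (ρ : ℂ) : ℝ) ≤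
      Cwχ * (1.01 * L + Real.log (Λ + 5)) := by
    intro t ht
    refine (hTχ t).trans (mul_le_mul_of_nonneg_left ?_ hCwχ0.le)
    rcases ht with rfl | rfl
    · simp only [abs_zero, zero_add]
      have : Real.log 4 ≤ Real.log (Λ + 5) := Real.log_le_log (by norm_num) (by linarith)
      linarith
    · linarith
  have hTζ' : ∀ t : ℝ, (t = 0 ∨ t = γ₀) → ∑ ρ ∈ nearZerosZeta t δ, (riemannZetaZeroOrder (ρ : ℂ) : ℝ) ≤
      Cwζ * (1.01 * L + Real.log (Λ + 5)) := by
    intro t ht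
    refine (hTζ t).trans (mul_le_mul_of_nonneg_left ?_ hCwζ0.le)
    have h2 : Real.log (|t| + 2) ≤ Real.log (|t| + 4) := Real.log_le_log (by positivity) (by linarith)
    rcases ht with rfl | rfl
    · simp only [abs_zero, zero_add] at h2 ⊢
      have : Real.log 4 ≤ Real.log (Λ + 5) := Real.log_le_log (by norm_num) (by linarith)
      linarith
    · linarith
  -- the logs
  have hlog2L : Real.log (2 / (σ₀ - 1)) = Real.log 2 + Real.log L := by
    rw [hσ₀1, div_div_eq_mul_div, div_one, Real.log_mul (by norm_num) hL0.ne']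
  have hlogL' : Real.log (1 / (σ₀ - 1)) = Real.log L := by rw [hσ₀1, one_div_one_div]
  have hlq : Real.log q = L := rfl
  have hl02 : Real.log (|(0:ℝ)| + 2) = Real.log 2 := by simp
  have hl03 : Real.log (|(0:ℝ)| + 3) = Real.log 3 := by simp
  have hl04 : Real.log (|(0:ℝ)| + 4) = Real.log 4 := by simp
  have hlγ2 : Real.log (|γ₀| + 2) ≤ L / 100 + Real.log (Λ + 5) :=
    (Real.log_le_log (by positivity) (by linarith)).trans hlogγ
  have hlγ3 : Real.log (|γ₀| + 3) ≤ L / 100 + Real.log (Λ + 5) :=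
    (Real.log_le_log (by positivity) (by linarith)).trans hlogγ
  have hcoef : (σ₀ - 1 + δ) / 0.74 ^ 2 ≤ 1.8262 * (1 / L + δ) := by
    rw [hσ₀1, div_le_iff₀ (by norm_num)]
    have : 0 ≤ 1 / L + δ := by positivity
    linarith only [this]
  have hcoef0 : 0 ≤ (σ₀ - 1 + δ) / 0.74 ^ 2 := by rw [hσ₀1]; positivity
  -- the total of the four `E`'s, bounded by `1.75644 L + lower order`
  have hlog2 : Real.log 2 ≤ 0.7 := by
    have := Real.log_two_lt_d9; linarith
  have hE : hfun 0 * ((0.861 * (Real.log (2 / (σ₀ - 1)) + Real.log q + Real.log (|(0:ℝ)| + 2) +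
        Real.log DirichletDisc.Zc) +
      (∑ ρ ∈ nearZeros hχ 0 δ, (DirichletDisc.zeroOrder χ (ρ : ℂ) : ℝ)) * ((σ₀ - 1 + δ) / 0.74 ^ 2)) +
      (0.861 * (Real.log (2 / (σ₀ - 1)) + Real.log q + Real.log (|γ₀| + 2) + Real.log DirichletDisc.Zc) +
      (∑ ρ ∈ nearZeros hχ γ₀ δ, (DirichletDisc.zeroOrder χ (ρ : ℂ) : ℝ)) * ((σ₀ - 1 + δ) / 0.74 ^ 2)) +
      (0.861 * (Real.log (2 / (σ₀ - 1)) + Real.log (1 / (σ₀ - 1)) + Real.log (|(0:ℝ)| + 3) + Real.log 21 +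
        2 * Real.log (|(0:ℝ)| + 4)) +
      (∑ ρ ∈ nearZerosZeta 0 δ, (riemannZetaZeroOrder (ρ : ℂ) : ℝ)) * ((σ₀ - 1 + δ) / 0.74 ^ 2)) +
      (0.861 * (Real.log (2 / (σ₀ - 1)) + Real.log (1 / (σ₀ - 1)) + Real.log (|γ₀| + 3) + Real.log 21 +
        2 * Real.log (|γ₀| + 4)) +
      (∑ ρ ∈ nearZerosZeta γ₀ δ, (riemannZetaZeroOrder (ρ : ℂ) : ℝ)) * ((σ₀ - 1 + δ) / 0.74 ^ 2))) ≤
      7.02576 * L + 0.0101 * L + (4 * 0.861 * (22 + C_E) + 0.04 + 200 * Cw) * Λ' := by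
    rw [hlog2L, hlogL', hlq, hl02, hl03, hl04]
    -- sums of multiplicities
    set A1 := ∑ ρ ∈ nearZeros hχ 0 δ, (DirichletDisc.zeroOrder χ (ρ : ℂ) : ℝ)
    set A2 := ∑ ρ ∈ nearZeros hχ γ₀ δ, (DirichletDisc.zeroOrder χ (ρ : ℂ) : ℝ)
    set A3 := ∑ ρ ∈ nearZerosZeta 0 δ, (riemannZetaZeroOrder (ρ : ℂ) : ℝ)
    set A4 := ∑ ρ ∈ nearZerosZeta γ₀ δ, (riemannZetaZeroOrder (ρ : ℂ) : ℝ)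
    have hA1 := hTχ' 0 (Or.inl rfl); have hA2 := hTχ' γ₀ (Or.inr rfl)
    have hA3 := hTζ' 0 (Or.inl rfl); have hA4 := hTζ' γ₀ (Or.inr rfl)
    have hA0 : 0 ≤ A1 + A2 + A3 + A4 := by
      have : 0 ≤ A1 := Finset.sum_nonneg fun _ _ ↦ Nat.cast_nonneg _
      have : 0 ≤ A2 := Finset.sum_nonneg fun _ _ ↦ Nat.cast_nonneg _
      have : 0 ≤ A3 := Finset.sum_nonneg fun ρ _ ↦ ZetaZeroSum.zeroOrder_nonneg ρ
      have : 0 ≤ A4 := Finset.sum_nonneg fun ρ _ ↦ ZetaZeroSum.zeroOrder_nonneg ρ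
      linarith
    set coef := (σ₀ - 1 + δ) / 0.74 ^ 2 with hcoefdef
    set L'' := 1.01 * L + Real.log (Λ + 5) with hL''
    have hL''0 : 0 ≤ L'' := by positivity
    have hAsum : A1 + A2 + A3 + A4 ≤ 2 * Cw * L'' := by simp only [hCw]; linarith
    -- `coef * (A1+..+A4) ≤ 1.8262 (1/L + δ) · 2 Cw L''`
    have hTcost : (A1 + A2 + A3 + A4) * coef ≤ 1.8262 * (1 / L + δ) * (2 * Cw * L'') := by
      calc (A1 + A2 + A3 + A4) * coef ≤ (2 * Cw * L'') * coef := mul_le_mul_of_nonneg_right hAsum hcoef0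
        _ ≤ (2 * Cw * L'') * (1.8262 * (1 / L + δ)) := mul_le_mul_of_nonneg_left hcoef (by positivity)
        _ = 1.8262 * (1 / L + δ) * (2 * Cw * L'') := by ring
    -- split `(1/L + δ) L'' = L''/L + δ L''`; `δ · 3.6524 Cw ≤ 0.0025`; `L''/L ≤ 1.01 + (Λ+4)/L ≤ 1.01 + Λ + 4`
    have hL''L : L'' / L ≤ 1.01 + (Λ + 4) := by
      rw [div_le_iff₀ hL0, hL'']
      have h1 : Real.log (Λ + 5) ≤ (Λ + 4) * L :=
        hlogΛ.trans (le_mul_of_one_le_right (by linarith only [hΛnn]) hL1)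
      have e : (1.01 + (Λ + 4)) * L = 1.01 * L + (Λ + 4) * L := by ring
      rw [e]; linarith only [h1]
    have hpart1 : 1.8262 * (1 / L) * (2 * Cw * L'') ≤ 3.6524 * Cw * (1.01 + (Λ + 4)) := by
      have e : 1.8262 * (1 / L) * (2 * Cw * L'') = 3.6524 * Cw * (L'' / L) := by ring
      rw [e]; exact mul_le_mul_of_nonneg_left hL''L (by positivity)
    have hpart2 : 1.8262 * δ * (2 * Cw * L'') ≤ 0.0025 * L'' := by
      have e : 1.8262 * δ * (2 * Cw * L'') = (3.6524 * Cw * δ) * L'' := by ring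
      rw [e]; exact mul_le_mul_of_nonneg_right hδCw hL''0
    have hh0 : 0 ≤ hfun 0 := shape_nonneg hε 0
    have hZc : 0 ≤ Real.log DirichletDisc.Zc := Real.log_nonneg DirichletDisc.one_le_Zc
    -- main estimate of the bracket
    have hbr : (0.861 * (Real.log 2 + Real.log L + L + Real.log 2 + Real.log DirichletDisc.Zc) + A1 * coef) +
        (0.861 * (Real.log 2 + Real.log L + L + Real.log (|γ₀| + 2) + Real.log DirichletDisc.Zc) + A2 * coef) +
        (0.861 * (Real.log 2 + Real.log L + Real.log L + Real.log 3 + Real.log 21 + 2 * Real.log 4) + A3 * coef) +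
        (0.861 * (Real.log 2 + Real.log L + Real.log L + Real.log (|γ₀| + 3) + Real.log 21 +
          2 * Real.log (|γ₀| + 4)) + A4 * coef) ≤
        0.861 * (2.04 * L + 6 * Real.log L + 4 * Real.log (Λ + 5) + C_E) +
          (3.6524 * Cw * (1.01 + (Λ + 4)) + 0.0025 * L'') := by
      have e : A1 * coef + A2 * coef + A3 * coef + A4 * coef = (A1 + A2 + A3 + A4) * coef := by ring
      have hsplit : 1.8262 * (1 / L + δ) * (2 * Cw * L'') =
          1.8262 * (1 / L) * (2 * Cw * L'') + 1.8262 * δ * (2 * Cw * L'') := by ring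
      simp only [hC_E]
      linarith only [hTcost, hpart1, hpart2, hlγ2, hlγ3, hlogγ, e, hsplit, hZc]
    -- multiply by `hfun 0 ≤ 4`
    have hbr0 : 0 ≤ 0.861 * (2.04 * L + 6 * Real.log L + 4 * Real.log (Λ + 5) + C_E) +
        (3.6524 * Cw * (1.01 + (Λ + 4)) + 0.0025 * L'') := by positivity
    have hfin : 4 * (0.861 * (2.04 * L + 6 * Real.log L + 4 * Real.log (Λ + 5) + C_E) +
        (3.6524 * Cw * (1.01 + (Λ + 4)) + 0.0025 * L'')) ≤
        7.02576 * L + 0.0101 * L + (4 * 0.861 * (22 + C_E) + 0.04 + 200 * Cw) * Λ' := by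
      have h1 : Real.log (Λ + 5) ≤ 4 * Λ' := by linarith only [hlogΛ, hΛ'Λ1, hΛ'1]
      have h2 : 6 * Real.log L + 4 * Real.log (Λ + 5) + C_E ≤ (22 + C_E) * Λ' := by
        have : C_E ≤ C_E * Λ' := le_mul_of_one_le_right hC_E0 hΛ'1
        have e : (22 + C_E) * Λ' = 6 * Λ' + 16 * Λ' + C_E * Λ' := by ring
        rw [e]; linarith only [this, h1, hΛ'log]
      have h3 : 3.6524 * Cw * (1.01 + (Λ + 4)) ≤ 3.6524 * Cw * (6.01 * Λ') :=
        mul_le_mul_of_nonneg_left (by linarith only [hΛ'Λ, hΛ'1]) (by positivity)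
      have h4 : 0.0025 * L'' ≤ 0.0025 * (1.01 * L) + 0.01 * Λ' := by
        simp only [hL'']; linarith only [h1]
      have h5 : 0 ≤ Cw * Λ' := by positivity
      have e1 : 3.6524 * Cw * (6.01 * Λ') = 21.950924 * (Cw * Λ') := by ring
      have e2 : (4 * 0.861 * (22 + C_E) + 0.04 + 200 * Cw) * Λ' =
          4 * 0.861 * ((22 + C_E) * Λ') + 0.04 * Λ' + 200 * (Cw * Λ') := by ring
      rw [e2]; rw [e1] at h3
      linarith only [h2, h3, h4, h5, hΛ'1]
    calc _ ≤ hfun 0 * (0.861 * (2.04 * L + 6 * Real.log L + 4 * Real.log (Λ + 5) + C_E) +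
          (3.6524 * Cw * (1.01 + (Λ + 4)) + 0.0025 * L'')) := mul_le_mul_of_nonneg_left hbr hh0
      _ ≤ 4 * (0.861 * (2.04 * L + 6 * Real.log L + 4 * Real.log (Λ + 5) + C_E) +
          (3.6524 * Cw * (1.01 + (Λ + 4)) + 0.0025 * L'')) := mul_le_mul_of_nonneg_right hh₀le hbr0
      _ ≤ _ := hfin
  /- ─────────── (B5): far zeros ─────────── -/
  have hΛ24 : 8 * (Λ + 2) + Sδ ≤ (24 + Sδ) * Λ' := by
    have : Sδ ≤ Sδ * Λ' := le_mul_of_one_le_right hSδ0 hΛ'1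
    have e : (24 + Sδ) * Λ' = 8 * Λ' + 16 * Λ' + Sδ * Λ' := by ring
    rw [e]; linarith only [this, hΛ'Λ, hΛ'1]
  have hCfar : 2 * hfun 0 * (α / L) + ∑ j ∈ Finset.Ico 1 6, |iteratedDeriv j hfun 0| * (2 / δ) ^ (j - 1) / L ^ j +
      4 * M₆ * Real.exp (α * 4) * (2 / δ) ^ (6 - 2) / L ^ (6 - 1) ≤
      (8 * (Λ + 2) + Sδ) / L + (4 * M₆ * (2 / δ) ^ 4 * E8 / C_r) := by
    have t1 : 2 * hfun 0 * (α / L) ≤ 8 * (Λ + 2) / L := by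
      rw [mul_div_assoc', div_le_div_iff_of_pos_right hL0]
      have := mul_le_mul hh₀le hαΛ hα0 (by norm_num)
      linarith
    have t2 : ∑ j ∈ Finset.Ico 1 6, |iteratedDeriv j hfun 0| * (2 / δ) ^ (j - 1) / L ^ j ≤ Sδ / L := by
      rw [hSδ, Finset.sum_div]
      refine Finset.sum_le_sum fun j hj ↦ ?_
      have hj1 : 1 ≤ j := (Finset.mem_Ico.1 hj).1
      refine div_le_div_of_nonneg_left (by positivity) hL0 ?_
      calc L = L ^ 1 := (pow_one L).symm
        _ ≤ L ^ j := pow_le_pow_right₀ hL1 hj1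
    have t3 : 4 * M₆ * Real.exp (α * 4) * (2 / δ) ^ (6 - 2) / L ^ (6 - 1) ≤ 4 * M₆ * (2 / δ) ^ 4 * E8 / C_r := by
      have he : Real.exp (α * 4) ≤ E8 * (L ^ 5 / C_r) := by
        have e1 : α * 4 = lam₀ * 4 + 4 := by simp only [hα]; ring
        rw [e1, Real.exp_add]
        calc Real.exp (lam₀ * 4) * Real.exp 4 ≤ Real.exp (4 - 4 * C_B) * (L ^ 5 / C_r) * Real.exp 4 :=
              mul_le_mul_of_nonneg_right hexp4' (Real.exp_nonneg _)
          _ = E8 * (L ^ 5 / C_r) := by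
              simp only [hE8]; rw [show (8 : ℝ) - 4 * C_B = (4 - 4 * C_B) + 4 by ring, Real.exp_add]; ring
      norm_num
      rw [div_le_iff₀ (by positivity)]
      calc 4 * M₆ * Real.exp (α * 4) * (2 / δ) ^ 4 ≤ 4 * M₆ * (E8 * (L ^ 5 / C_r)) * (2 / δ) ^ 4 := by
            gcongr
        _ = 4 * M₆ * (2 / δ) ^ 4 * E8 / C_r * L ^ 5 := by field_simp
    have e : (8 * (Λ + 2) + Sδ) / L = 8 * (Λ + 2) / L + Sδ / L := by ring
    rw [e]; linarith only [t1, t2, t3]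
  have hCfar0 : 0 ≤ (8 * (Λ + 2) + Sδ) / L + (4 * M₆ * (2 / δ) ^ 4 * E8 / C_r) := by positivity
  have hδL4 : δ * L / 4 ≤ L / 4 := by
    have := mul_le_mul_of_nonneg_right (show δ ≤ 1 by linarith) hL0.le; linarith
  have hfarfac : ∀ t : ℝ, (t = 0 ∨ t = γ₀) → Real.log q + Real.log (|t| + 4) ≤ 2.01 * L := by
    intro t ht
    rw [hlq]
    rcases ht with rfl | rfl
    · simp only [abs_zero, zero_add]
      have h1 : Real.log 4 ≤ Real.log (Λ + 5) := Real.log_le_log (by norm_num) (by linarith)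
      have h2 : Real.log (Λ + 5) ≤ L := by linarith only [hlogΛ, hΛL, hδL4, hL4]
      linarith
    · linarith only [hlogγL]
  have hfarfacζ : ∀ t : ℝ, (t = 0 ∨ t = γ₀) → Real.log (|t| + 4) ≤ 2.01 * L := by
    intro t ht; have := hfarfac t ht; rw [hlq] at this; linarith only [this, hL0]
  have hFarχ : ∀ t : ℝ, (t = 0 ∨ t = γ₀) →
      ‖∑' ρ : ↑((nearZeros hχ t δ : Set (charNontrivialZeros χ))ᶜ),
        (DirichletDisc.zeroOrder χ ((ρ : charNontrivialZeros χ) : ℂ) : ℂ) *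
          fordLaplace₀ g ((σ₀ : ℂ) + t * I - (ρ : charNontrivialZeros χ))‖ ≤
      Cfχ / δ ^ 2 * 2.01 * (24 + Sδ) * Λ' + L / 200 := by
    intro t ht
    have h := hCfχ q χ hprim hq 4 (1 / 100) (1 / 100) L α hε hεx hL0 hα0 6 M₆ (by norm_num) hM₆ σ₀ t δ
      hσ₀gt hδ0 (by linarith) hαL hcenter
    refine h.trans ?_
    have h1 : Cfχ / δ ^ 2 * (Real.log q + Real.log (|t| + 4)) ≤ Cfχ / δ ^ 2 * (2.01 * L) :=
      mul_le_mul_of_nonneg_left (hfarfac t ht) (by positivity)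
    have hlog0 : 0 ≤ Real.log q + Real.log (|t| + 4) := by
      rw [hlq]; have := Real.log_nonneg (by linarith [abs_nonneg t] : (1:ℝ) ≤ |t| + 4); positivity
    calc Cfχ / δ ^ 2 * (Real.log q + Real.log (|t| + 4)) *
          (2 * hfun 0 * (α / L) + ∑ j ∈ Finset.Ico 1 6, |iteratedDeriv j hfun 0| * (2 / δ) ^ (j - 1) / L ^ j +
            4 * M₆ * Real.exp (α * 4) * (2 / δ) ^ (6 - 2) / L ^ (6 - 1))
        ≤ Cfχ / δ ^ 2 * (2.01 * L) * ((8 * (Λ + 2) + Sδ) / L + (4 * M₆ * (2 / δ) ^ 4 * E8 / C_r)) :=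
          mul_le_mul h1 hCfar (by
            have := shape_nonneg (x₀ := 4) (ε₀ := 1/100) hε 0
            positivity) (by positivity)
      _ = Cfχ / δ ^ 2 * 2.01 * (8 * (Λ + 2) + Sδ) + (Kχ / C_r) * L := by
          simp only [hKχ]; field_simp
      _ ≤ Cfχ / δ ^ 2 * 2.01 * (24 + Sδ) * Λ' + L / 200 := by
          have e1 : Cfχ / δ ^ 2 * 2.01 * (8 * (Λ + 2) + Sδ) ≤ Cfχ / δ ^ 2 * 2.01 * ((24 + Sδ) * Λ') :=
            mul_le_mul_of_nonneg_left hΛ24 (by positivity)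
          have e2 : Kχ / C_r ≤ 1 / 200 := by
            rw [div_le_div_iff₀ hC_r0 (by norm_num)]; simp only [hC_r]; linarith only [hKχ0, hKζ0, show (0:ℝ) ≤ 256 * M₆ * Real.exp (4 - 4 * C_B) / δ ^ 6 by positivity]
          have e3 := mul_le_mul_of_nonneg_right e2 hL0.le
          linarith
  have hFarζ : ∀ t : ℝ, (t = 0 ∨ t = γ₀) →
      ‖∑' ρ : ↑((nearZerosZeta t δ : Set RHWave0.riemannZetaNontrivialZeros)ᶜ),
        (riemannZetaZeroOrder ((ρ : RHWave0.riemannZetaNontrivialZeros) : ℂ) : ℂ) *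
          fordLaplace₀ g ((σ₀ : ℂ) + t * I - (ρ : RHWave0.riemannZetaNontrivialZeros))‖ ≤
      Cfζ / δ ^ 2 * 2.01 * (24 + Sδ) * Λ' + L / 200 := by
    intro t ht
    have h := hCfζ 4 (1 / 100) (1 / 100) L α hε hεx hL0 hα0 6 M₆ (by norm_num) hM₆ σ₀ t δ
      hσ₀gt hσ₀lt hδ0 (by linarith) hαL hcenter
    refine h.trans ?_
    have h1 : Cfζ / δ ^ 2 * Real.log (|t| + 4) ≤ Cfζ / δ ^ 2 * (2.01 * L) :=
      mul_le_mul_of_nonneg_left (hfarfacζ t ht) (by positivity)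
    have hlog0 : 0 ≤ Real.log (|t| + 4) := Real.log_nonneg (by linarith [abs_nonneg t])
    calc Cfζ / δ ^ 2 * Real.log (|t| + 4) *
          (2 * hfun 0 * (α / L) + ∑ j ∈ Finset.Ico 1 6, |iteratedDeriv j hfun 0| * (2 / δ) ^ (j - 1) / L ^ j +
            4 * M₆ * Real.exp (α * 4) * (2 / δ) ^ (6 - 2) / L ^ (6 - 1))
        ≤ Cfζ / δ ^ 2 * (2.01 * L) * ((8 * (Λ + 2) + Sδ) / L + (4 * M₆ * (2 / δ) ^ 4 * E8 / C_r)) :=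
          mul_le_mul h1 hCfar (by
            have := shape_nonneg (x₀ := 4) (ε₀ := 1/100) hε 0
            positivity) (by positivity)
      _ = Cfζ / δ ^ 2 * 2.01 * (8 * (Λ + 2) + Sδ) + (Kζ / C_r) * L := by
          simp only [hKζ]; field_simp
      _ ≤ Cfζ / δ ^ 2 * 2.01 * (24 + Sδ) * Λ' + L / 200 := by
          have e1 : Cfζ / δ ^ 2 * 2.01 * (8 * (Λ + 2) + Sδ) ≤ Cfζ / δ ^ 2 * 2.01 * ((24 + Sδ) * Λ') :=
            mul_le_mul_of_nonneg_left hΛ24 (by positivity)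
          have e2 : Kζ / C_r ≤ 1 / 200 := by
            rw [div_le_div_iff₀ hC_r0 (by norm_num)]; simp only [hC_r]; linarith only [hKχ0, hKζ0, show (0:ℝ) ≤ 256 * M₆ * Real.exp (4 - 4 * C_B) / δ ^ 6 by positivity]
          have e3 := mul_le_mul_of_nonneg_right e2 hL0.le
          linarith
  /- ─────────── (B6), (B7): left lines and trivial zeros ─────────── -/
  have hB : 2 * hfun 0 * (α / L) + 4 * |deriv hfun 0| / L + 16 * M₂ / L ^ 2 ≤ (8 * (Λ + 2) + 4 * h₁ + 16 * M₂) / L := by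
    have t1 : 2 * hfun 0 * (α / L) ≤ 8 * (Λ + 2) / L := by
      rw [mul_div_assoc', div_le_div_iff_of_pos_right hL0]
      have := mul_le_mul hh₀le hαΛ hα0 (by norm_num)
      linarith
    have t3 : 16 * M₂ / L ^ 2 ≤ 16 * M₂ / L := by
      refine div_le_div_of_nonneg_left (by positivity) hL0 ?_
      calc L = L ^ 1 := (pow_one L).symm
        _ ≤ L ^ 2 := pow_le_pow_right₀ hL1 (by norm_num)
    have e : (8 * (Λ + 2) + 4 * h₁ + 16 * M₂) / L = 8 * (Λ + 2) / L + 4 * h₁ / L + 16 * M₂ / L := by ring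
    rw [e, hh₁]; linarith only [t1, t3]
  have hB0 : 0 ≤ 2 * hfun 0 * (α / L) + 4 * |deriv hfun 0| / L + 16 * M₂ / L ^ 2 := by
    have := shape_nonneg (x₀ := 4) (ε₀ := 1/100) hε 0; positivity
  have hBnum0 : 0 ≤ 8 * (Λ + 2) + 4 * h₁ + 16 * M₂ := by
    have h1' : 0 ≤ h₁ := abs_nonneg _
    linarith only [hΛnn, h1', hM₂0]
  have hBΛ : (8 * (Λ + 2) + 4 * h₁ + 16 * M₂) ≤ (24 + 4 * h₁ + 16 * M₂) * Λ' := by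
    have h1' : 0 ≤ h₁ := abs_nonneg _
    have : 4 * h₁ + 16 * M₂ ≤ (4 * h₁ + 16 * M₂) * Λ' := le_mul_of_one_le_right (by positivity) hΛ'1
    have e : (24 + 4 * h₁ + 16 * M₂) * Λ' = 8 * Λ' + 16 * Λ' + (4 * h₁ + 16 * M₂) * Λ' := by ring
    rw [e]; linarith only [this, hΛ'Λ, hΛ'1]
  have hsre : ∀ t : ℝ, ((σ₀ : ℂ) + t * I).re = σ₀ := fun t ↦ by simp
  have hJfac : ∀ t : ℝ, (t = 0 ∨ t = γ₀) → Real.log q + Real.log (1 + |t|) ≤ 2.01 * L ∧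
      1 + Real.log (1 + |t|) ≤ 2.01 * L := by
    intro t ht
    have h1 : Real.log (1 + |t|) ≤ Real.log (|t| + 4) := Real.log_le_log (by positivity) (by linarith)
    have h2 := hfarfacζ t ht
    have h3 : Real.log (1 + |t|) ≤ 1.01 * L := by
      rcases ht with rfl | rfl
      · simp only [abs_zero, add_zero, Real.log_one]; linarith only [hL0]
      · linarith only [h1, hlogγL]
    rw [hlq]
    exact ⟨by linarith, by linarith⟩
  have hJχ : ∀ t : ℝ, (t = 0 ∨ t = γ₀) → ‖charEFRemainder χ g ((σ₀ : ℂ) + t * I)‖ ≤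
      CJχ * 2.01 * (24 + 4 * h₁ + 16 * M₂) * Λ' := by
    intro t ht
    have h := hCJχ q χ hprim hq 4 (1 / 100) (1 / 100) L α hε hεx hL0 hα0 hαL4 M₂ hM₂ ((σ₀ : ℂ) + t * I)
      (by rw [hsre]; linarith only [hσ₀gt])
    refine h.trans ?_
    have him : ((σ₀ : ℂ) + t * I).im = t := by simp
    rw [him]
    calc CJχ * (2 * hfun 0 * (α / L) + 4 * |deriv hfun 0| / L + 16 * M₂ / L ^ 2) * (Real.log q + Real.log (1 + |t|))
        ≤ CJχ * ((8 * (Λ + 2) + 4 * h₁ + 16 * M₂) / L) * (2.01 * L) :=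
          mul_le_mul (mul_le_mul_of_nonneg_left hB hCJχ0.le) (hJfac t ht).1
            (by rw [hlq]; exact add_nonneg hL0.le (Real.log_nonneg (by linarith only [abs_nonneg t])))
            (mul_nonneg hCJχ0.le (div_nonneg hBnum0 hL0.le))
      _ = CJχ * 2.01 * (8 * (Λ + 2) + 4 * h₁ + 16 * M₂) := by field_simp
      _ ≤ CJχ * 2.01 * ((24 + 4 * h₁ + 16 * M₂) * Λ') := mul_le_mul_of_nonneg_left hBΛ (by positivity)
      _ = CJχ * 2.01 * (24 + 4 * h₁ + 16 * M₂) * Λ' := by ring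
  have hJζ : ∀ t : ℝ, (t = 0 ∨ t = γ₀) → ‖smoothedEFRemainder g ((σ₀ : ℂ) + t * I)‖ ≤
      CJζ * 2.01 * (24 + 4 * h₁ + 16 * M₂) * Λ' := by
    intro t ht
    have h := hCJζ 4 (1 / 100) (1 / 100) L α hε hεx hL0 hα0 hαL4 M₂ hM₂ ((σ₀ : ℂ) + t * I)
      (by rw [hsre]; linarith only [hσ₀gt])
    refine h.trans ?_
    have him : ((σ₀ : ℂ) + t * I).im = t := by simp
    rw [him]
    calc CJζ * (2 * hfun 0 * (α / L) + 4 * |deriv hfun 0| / L + 16 * M₂ / L ^ 2) * (1 + Real.log (1 + |t|))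
        ≤ CJζ * ((8 * (Λ + 2) + 4 * h₁ + 16 * M₂) / L) * (2.01 * L) :=
          mul_le_mul (mul_le_mul_of_nonneg_left hB hCJζ0.le) (hJfac t ht).2
            (add_nonneg zero_le_one (Real.log_nonneg (by linarith only [abs_nonneg t])))
            (mul_nonneg hCJζ0.le (div_nonneg hBnum0 hL0.le))
      _ = CJζ * 2.01 * (8 * (Λ + 2) + 4 * h₁ + 16 * M₂) := by field_simp
      _ ≤ CJζ * 2.01 * ((24 + 4 * h₁ + 16 * M₂) * Λ') := mul_le_mul_of_nonneg_left hBΛ (by positivity)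
      _ = CJζ * 2.01 * (24 + 4 * h₁ + 16 * M₂) * Λ' := by ring
  have hTr : ∀ t : ℝ, ‖∑ τ ∈ charTrivialZeroFinset hχ,
      (DirichletDisc.zeroOrder χ τ : ℂ) * fordLaplace₀ g ((σ₀ : ℂ) + t * I - τ)‖ ≤
      2 * (24 + 4 * h₁ + 16 * M₂) * Λ' := by
    intro t
    have h := norm_trivial_testFn_le hprim hq (ε₀ := 1/100) (α := α) hε hεx hL0 hα0 hαL4 hM₂
      (s := (σ₀ : ℂ) + t * I) (by rw [hsre]; linarith only [hσ₀gt])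
    refine h.trans ?_
    have h1 : (8 * (Λ + 2) + 4 * h₁ + 16 * M₂) / L ≤ (24 + 4 * h₁ + 16 * M₂) * Λ' :=
      (div_le_self hBnum0 hL1).trans hBΛ
    linarith only [hB, h1]
  /- ─────────── the contradiction ─────────── -/
  have hF1 := hFarχ 0 (Or.inl rfl); have hF2 := hFarχ γ₀ (Or.inr rfl)
  have hF3 := hFarζ 0 (Or.inl rfl); have hF4 := hFarζ γ₀ (Or.inr rfl)
  have hJ1 := hJχ 0 (Or.inl rfl); have hJ2 := hJχ γ₀ (Or.inr rfl)
  have hJ3 := hJζ 0 (Or.inl rfl); have hJ4 := hJζ γ₀ (Or.inr rfl)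
  have hT1 := hTr 0; have hT2 := hTr γ₀
  -- `c_low Λ' ≤ 0.3 L`
  have hlow : c_low * Λ' ≤ 0.3 * L := by
    have h1 := hL₁ L hLL₁
    have h2 : Λ' ≤ 9 / 4 * Real.log L + (Real.log C_r / 4 + 1) := by
      simp only [hΛ']; linarith only [hΛle, hlogCr]
    calc c_low * Λ' ≤ c_low * (9 / 4 * Real.log L + (Real.log C_r / 4 + 1)) :=
          mul_le_mul_of_nonneg_left h2 hc_low0
      _ = c_low * (9 / 4) * Real.log L + c_low * (Real.log C_r / 4 + 1) := by ring
      _ ≤ 0.3 * L := h1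
  have hLH : 7.64 * L ≤ L * H0 := by nlinarith only [hH0ge, hL0]
  -- unfold `c_low` in `hlow` as a sum of the budgets
  have hbud : (2 * S₀ / δ + 1) + (4 * 0.861 * (22 + C_E) + 0.04 + 200 * Cw) * Λ' +
      (2 * (Cfχ / δ ^ 2 * 2.01 * (24 + Sδ)) * Λ' + 2 * (Cfζ / δ ^ 2 * 2.01 * (24 + Sδ)) * Λ') +
      (2 * (CJχ * 2.01 * (24 + 4 * h₁ + 16 * M₂)) * Λ' + 2 * (CJζ * 2.01 * (24 + 4 * h₁ + 16 * M₂)) * Λ') +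
      4 * (24 + 4 * h₁ + 16 * M₂) * Λ' ≤ 0.3 * L := by
    have h1 : 2 * S₀ / δ + 1 ≤ (2 * S₀ / δ + 1) * Λ' := le_mul_of_one_le_right (by positivity) hΛ'1
    have e : c_low * Λ' = (2 * S₀ / δ + 1) * Λ' + (4 * 0.861 * (22 + C_E) + 0.04 + 200 * Cw) * Λ' +
        (2 * (Cfχ / δ ^ 2 * 2.01 * (24 + Sδ)) * Λ' + 2 * (Cfζ / δ ^ 2 * 2.01 * (24 + Sδ)) * Λ') +
        (2 * (CJχ * 2.01 * (24 + 4 * h₁ + 16 * M₂)) * Λ' + 2 * (CJζ * 2.01 * (24 + 4 * h₁ + 16 * M₂)) * Λ') +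
        4 * (24 + 4 * h₁ + 16 * M₂) * Λ' := by simp only [hc_low]; ring
    linarith only [hlow, h1, e]
  simp only [hhfun] at hE
  linarith only [core, hT12, hIns, hE, hF1, hF2, hF3, hF4, hJ1, hJ2, hJ3, hJ4, hT1, hT2, hbud, hLH, hL0, hH0]

end DHTest

end Literature.NumberTheory.LFunctions

end
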